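import Literature.AlgebraicGeometry.Motives.GrassmannianClassifyOfKernelLe
import Literature.AlgebraicGeometry.Motives.FlatFamilyGrassmannianPoint
import Literature.AlgebraicGeometry.Motives.GrassmannianUniversalSubbundle
import Literature.AlgebraicGeometry.Motives.GrassmannianUniversalSubbundleSections
import Literature.AlgebraicGeometry.Modules.SerreTwistMonomialSections
import Literature.AlgebraicGeometry.Modules.SubbundleEquationsBaseChange
import Literature.AlgebraicGeometry.Modules.SerreTwistModBaseChange
import Literature.AlgebraicGeometry.Modules.PullbackSectionsBaseChange
import Literature.AlgebraicGeometry.Modules.PullbackFrame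
import Literature.AlgebraicGeometry.Morphisms.ProjectiveSpaceOverBasePoints
import Literature.AlgebraicGeometry.Morphisms.AffineSpaceCompactification
import Mathlib.RingTheory.Grassmannian
import Mathlib.RingTheory.Spectrum.Prime.FreeLocus
import HarnessLib

/-!
# `Hilb ↪ Grass`: the vanishing locus of the equations of a Grassmannian point (Mumford, Lect. 15 (III.)–(V.)) — ed. 1

Topic `AlgebraicGeometry/Motives`; namespaces `Literature.AlgebraicGeometry.Motives.Grassmannian` (§1) and `….Motives` (§2–§4).
THEOREMS ONLY (no definition / instance / notation / named fact / `sorry`).  F-5 (5d) step (III-Gr) of cell `hodgecm-mathlib`: the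
bookkeeping half of «the image of `Hilb^P_{𝐏ⁿ}` in `Gr = Grass_{P(d)}(ℤ^{(Mon_d)})` is represented» ([Mumford1966CurvesSurface] Lect. 15,
(III.) `K ⊆ K′` of equal corank `⇒ K = K′`, (IV.) «`Z_K ×_S T = Z_{h^* K}`», (V.) the point of `Z_K` over the stratum is `K`):
* §1 `moduleGrassmannian_eq_of_le`, `eq_of_forall_evalAffine_le` — points of the Grassmannian are INCOMPARABLE (Mathlib
  `Module.rankAtStalk_prod`): two `T`-points, one contained in the other on every affine open, are equal;
* §2 **`eq_of_classifies_of_le_ker_vanishingIdeal`** — (L-iv) if `Z ⊂ 𝐏(ι; T)` lies in the vanishing locus of the degree-`d` equations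
  `ker ψ = g^*𝒦` of `g : T ⟶ Gr` and `g′` classifies `Z` through the monomial sections of `𝒪_Z(d)` (letter of ★ β
  `existsUnique_hom_grassmannian_of_forall_fieldPoint`), then `g = g′`;
* §3 **(K)** `vanishingIdeal_transpose_kernel_ι_comp_eq(_of_forall_exists/_of_ker_sectionsMap_eq)` — the closed subscheme
  `V((kι_ψ ≫ φ)♭)` (★ `Modules/VanishingLocusOfHom`, ★ `SubbundleEquationsBaseChange`) depends only on the `φ`-values of the local sections
  killed by `ψ`; `vanishingIdeal_transpose_comp_pushforward_map_eq` — nor does it see an isomorphism of the target bundle;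
* §4 **(EqBC) `comap_vanishingIdeal_universalEquations_eq`** — (IV.) in ideal form: the pull-back along `𝐏(g) : 𝐏(ι; T) → 𝐏(ι; Gr)` of
  the ideal of the UNIVERSAL equations `V((kι_𝒦 ≫ φ_{Gr})♭)` is the ideal `V((kι_{ψ_T} ≫ φ_T)♭)` of the equations of ANY presentation
  `ψ_T` in the class `g` (+ `projectiveSpaceMap_comp`, `exists_sectionsMap_unitSection_freeSectionOn_eq`).
Ed. 2 (append-only) adds the two heads (H1) «`(∃! v, v ≫ j = g) ↔ ∃` flat `Z` with Hilbert polynomial `P` classified by `g`» and (H2) the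
Hilbert-scheme universal property of `Z_j ⊂ 𝐏(ι; H)`, as `…_of` theorems over the flattening-stratum head (slot ⑩
`Modules/FlatteningStratumHilbertPolynomial`), the relative cut-out theorem (II′) `Motives/FlatFamilyCutOutByDegreeEquations` and FILE γ.
References: [Mumford1966CurvesSurface, Lecture 15 (III.)–(V.) (pp. 105–108)]; [GortzWedhorn2020, (8.4) (pp. 213–215), Prop. 4.20];
[Hartshorne1977, II §5 (pp. 109–110), II Prop. 5.12 (c), II Ex. 1.8]; [Fulton1998, B.3.4]; [StacksProject, Tags 089R, 01NF].
Count-neutral Mathlib-side capital; nothing here is about HC — HC_CM is proved only modulo the 7 printed citations until rung 0 closes.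
-/

noncomputable section
-- `TopCat.Presheaf`/`Scheme.Modules` are not reducible (as in Mathlib's `AlgebraicGeometry/Modules/Tilde.lean`).
set_option backward.isDefEq.respectTransparency false

open CategoryTheory Opposite TensorProduct TopologicalSpace AlgebraicGeometry Limits
open Literature.AlgebraicGeometry.Motives

universe u

namespace Literature.AlgebraicGeometry.Motives.Grassmannian

open Literature.AlgebraicGeometry.Modules

/-! ## §1 Points of the Grassmannian are incomparable -/

/-- **Points of the Grassmannian are incomparable**: if `N₁ ≤ N₂` are submodules of `M` whose quotients are both finite projective
of constant rank `k` (points of Mathlib's `Module.Grassmannian R M k`), then `N₁ = N₂` — the surjection `M ⧸ N₁ ↠ M ⧸ N₂` splits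
(projective target), `M ⧸ N₁ ≅ (M ⧸ N₂) × ker`, ranks add (Mathlib `Module.rankAtStalk_prod`), so the finite projective kernel has rank `0`
everywhere and vanishes (`Module.rankAtStalk_eq_zero_iff_subsingleton`).  The module half of «`K ⊆ K′` with equal coranks ⇒ `K = K′`»
([Mumford1966CurvesSurface] Lect. 15 (III)). [cite: StacksProject, Tag 089R] [cite: Mumford1966CurvesSurface, Lecture 15 (III) (pp. 105–108)] -/
theorem moduleGrassmannian_eq_of_le {R : Type*} [CommRing R] {M : Type*} [AddCommGroup M] [Module R M] {k : ℕ}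
    {N₁ N₂ : Module.Grassmannian R M k} (h : (N₁ : Submodule R M) ≤ N₂) : N₁ = N₂ := by
  set f : (M ⧸ (N₁ : Submodule R M)) →ₗ[R] (M ⧸ (N₂ : Submodule R M)) := Submodule.factor h with hf_def
  have hf : Function.Surjective f := Submodule.factor_surjective h
  obtain ⟨s, hs⟩ := f.exists_rightInverse_of_surjective (LinearMap.range_eq_top.2 hf)
  have hfs : ∀ y, f (s y) = y := fun y => by
    have := LinearMap.congr_fun hs y
    simpa using this
  let g : (M ⧸ (N₁ : Submodule R M)) →ₗ[R] LinearMap.ker f :=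
    (LinearMap.id - s.comp f).codRestrict (LinearMap.ker f) fun x => by
      rw [LinearMap.mem_ker, LinearMap.sub_apply, map_sub, LinearMap.id_apply, LinearMap.comp_apply, hfs, sub_self]
  let e : (M ⧸ (N₁ : Submodule R M)) ≃ₗ[R] (M ⧸ (N₂ : Submodule R M)) × LinearMap.ker f :=
    LinearEquiv.ofBijective (LinearMap.prod f g)
      ⟨fun x y hxy => by
        have h1 : f x = f y := congrArg Prod.fst hxy
        have h2 : x - s (f x) = y - s (f y) := congrArg (fun p => ((p.2 : LinearMap.ker f) : M ⧸ (N₁ : Submodule R M))) hxy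
        rw [h1] at h2
        exact sub_left_inj.mp h2,
       fun yz => ⟨s yz.1 + (yz.2 : M ⧸ (N₁ : Submodule R M)), by
        obtain ⟨y, z, hz⟩ := yz
        have hz0 : f z = 0 := hz
        refine Prod.ext ?_ (Subtype.ext ?_)
        · change f (s y + z) = y
          rw [map_add, hfs, hz0, add_zero]
        · change (s y + z) - s (f (s y + z)) = z
          rw [map_add, hfs, hz0, add_zero, add_sub_cancel_left]⟩⟩
  let π₂ : (M ⧸ (N₁ : Submodule R M)) →ₗ[R] LinearMap.ker f :=
    (LinearMap.snd R (M ⧸ (N₂ : Submodule R M)) (LinearMap.ker f)).comp e.toLinearMap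
  let σ₂ : LinearMap.ker f →ₗ[R] (M ⧸ (N₁ : Submodule R M)) :=
    e.symm.toLinearMap.comp (LinearMap.inr R (M ⧸ (N₂ : Submodule R M)) (LinearMap.ker f))
  have hπσ : π₂.comp σ₂ = LinearMap.id := by
    ext z
    simp [π₂, σ₂]
  haveI : Module.Finite R (LinearMap.ker f) :=
    Module.Finite.of_surjective (R := R) (S := R) (M := M ⧸ (N₁ : Submodule R M)) (P := LinearMap.ker f) π₂
      ((LinearMap.snd_surjective (R := R) (M := M ⧸ (N₂ : Submodule R M)) (M₂ := LinearMap.ker f)).comp e.surjective)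
  haveI : Module.Projective R (LinearMap.ker f) :=
    Module.Projective.of_split (R := R) (M := M ⧸ (N₁ : Submodule R M)) (P := LinearMap.ker f) σ₂ π₂ hπσ
  have hrank := Module.rankAtStalk_eq_of_equiv e
  rw [Module.rankAtStalk_prod] at hrank
  have hker : Module.rankAtStalk (R := R) (LinearMap.ker f) = 0 := by
    funext p
    have := congrFun hrank p
    simp only [Pi.add_apply, N₁.rankAtStalk_eq p, N₂.rankAtStalk_eq p] at this
    simp only [Pi.zero_apply]
    omega
  haveI : Subsingleton (LinearMap.ker f) := Module.rankAtStalk_eq_zero_iff_subsingleton.1 hker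
  refine Module.Grassmannian.ext (le_antisymm h fun x hx => ?_)
  have hx0 : f (Submodule.Quotient.mk x) = 0 := by
    change Submodule.factor h (Submodule.mkQ _ x) = 0
    rw [Submodule.factor_mk]
    exact (Submodule.Quotient.mk_eq_zero _).2 hx
  have : (⟨Submodule.Quotient.mk x, hx0⟩ : LinearMap.ker f) = 0 := Subsingleton.elim _ _
  have hx1 : (Submodule.Quotient.mk x : M ⧸ (N₁ : Submodule R M)) = 0 := congrArg Subtype.val this
  exact (Submodule.Quotient.mk_eq_zero _).1 hx1

variable (k : ℕ) (M : Type u) [AddCommGroup M] [(grassmannianSheaf M k).obj.IsRepresentable] {T : Scheme.{u}}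

/-- **Two `T`-points of the Grassmannian one of which is contained in the other on every affine open are EQUAL** (§1 on the affine
values + ★ `hom_ext_of_evalAffine`). [cite: GortzWedhorn2020, (8.4) (pp. 213–215)] [cite: StacksProject, Tag 089R] -/
theorem eq_of_forall_evalAffine_le {f g : T ⟶ grassmannianScheme M k}
    (h : ∀ V : T.affineOpens, (evalAffine V.2 (pointsEquiv M k T f)).toSubmodule ≤ (evalAffine V.2 (pointsEquiv M k T g)).toSubmodule) :
    f = g :=
  hom_ext_of_evalAffine M k fun V hV => moduleGrassmannian_eq_of_le (h ⟨V, hV⟩)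

end Literature.AlgebraicGeometry.Motives.Grassmannian

/-! ## §2 (L-iv) — the `Gr`-point of the vanishing locus `Z_g = V(equations of g)` is `g` itself -/

namespace Literature.AlgebraicGeometry.Motives

open Literature.AlgebraicGeometry.Modules Literature.AlgebraicGeometry.Motives.Grassmannian

section PointOfVanishingLocus

variable {ι : Type} {T : Scheme.{0}} (d k : ℕ)
  [(grassmannianSheaf ((Fin d → Fin (Nat.card ι + 1)) →₀ ℤ) k).obj.IsRepresentable]
  (g g' : T ⟶ grassmannianScheme ((Fin d → Fin (Nat.card ι + 1)) →₀ ℤ) k)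
  -- the quotient map `ψ : 𝒪_T^{(J)} ↠ g^*𝒬`, `ε_w ↦ η(q_w)`
  (ψ : freeModule T (Fin d → Fin (Nat.card ι + 1)) ⟶
    (Scheme.Modules.pullback g).obj (universalQuotient k ((Fin d → Fin (Nat.card ι + 1)) →₀ ℤ) Finsupp.basisSingleOne))
  (hψ : ∀ (w : Fin d → Fin (Nat.card ι + 1)) (V : T.Opens), ψ.app V (freeSectionOn T w V) =
    ((Scheme.Modules.pullback g).obj (universalQuotient k _ Finsupp.basisSingleOne)).presheaf.map (homOfLE (le_top : V ≤ ⊤)).op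
      (unitSection g (universalQuotient k _ Finsupp.basisSingleOne) ⊤
        (universalQuotientSection k ((Fin d → Fin (Nat.card ι + 1)) →₀ ℤ) Finsupp.basisSingleOne w)))
  -- the monomial map `φℙ : 𝒪_T^{(J)} ⟶ π_* 𝒪_𝐏(d)` of `𝐏(ι; T)`, `ε_w ↦ μ_w`
  (φP : freeModule T (Fin d → Fin (Nat.card ι + 1)) ⟶
    (Scheme.Modules.pushforward (Morphisms.projectiveSpaceFst ι T)).obj
      (SerreTwist.twistMod (pullback.snd (terminal.from T) (terminal.from (Morphisms.projectiveSpaceInt ι)))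
        (unitModule (Morphisms.projectiveSpace ι T)) d))
  (hφP : ∀ (w : Fin d → Fin (Nat.card ι + 1)) (V : T.Opens), φP.app V (freeSectionOn T w V) =
    (SerreTwist.twistMod (pullback.snd (terminal.from T) (terminal.from (Morphisms.projectiveSpaceInt ι)))
        (unitModule (Morphisms.projectiveSpace ι T)) d).presheaf.map
      (homOfLE (le_top : (Morphisms.projectiveSpaceFst ι T) ⁻¹ᵁ V ≤ ⊤)).op
      (SerreTwist.monomialSection (pullback.snd (terminal.from T) (terminal.from (Morphisms.projectiveSpaceInt ι))) d w))
  -- a closed subscheme `Z ⊆ V((kι ≫ φℙ)♭)` of `𝐏(ι; T)` ...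
  {Z : Scheme.{0}} (iZ : Z ⟶ Morphisms.projectiveSpace ι T)
  (hZ : vanishingIdeal (((Scheme.Modules.pullbackPushforwardAdjunction (Morphisms.projectiveSpaceFst ι T)).homEquiv _ _).symm
      (kernel.ι ψ ≫ φP)) ≤ iZ.ker)
  -- ... whose `Gr`-point through the monomial sections of `𝒪_Z(d)` is `g'`
  (hcl : ∀ V : T.affineOpens,
    (evalAffine V.2 (pointsEquiv ((Fin d → Fin (Nat.card ι + 1)) →₀ ℤ) k T g')).toSubmodule =
      LinearMap.ker (sectionsMap (Finsupp.basisSingleOne : Module.Basis (Fin d → Fin (Nat.card ι + 1)) ℤ _)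
        ((Scheme.Modules.pushforward (iZ ≫ Morphisms.projectiveSpaceFst ι T)).obj
          (SerreTwist.twistMod (iZ ≫ pullback.snd (terminal.from T) (terminal.from (Morphisms.projectiveSpaceInt ι)))
            (unitModule Z) d))
        (fun w => SerreTwist.monomialSection
          (iZ ≫ pullback.snd (terminal.from T) (terminal.from (Morphisms.projectiveSpaceInt ι))) d w) V))

include hψ hφP hZ hcl in
/-- **(L-iv) THE `Gr`-POINT OF THE VANISHING LOCUS OF THE EQUATIONS OF `g` IS `g`** ([Mumford1966CurvesSurface] Lect. 15 (III): «the
point of the universal family over the stratum is the identity»).  Let `g : T ⟶ Grass_k(ℤ^{(Mon_d)})`, `ψ : 𝒪_T^{(Mon_d)} ↠ g^*𝒬` its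
quotient map, `φℙ` the monomial map of `𝐏(ι; T)`, and `Z ⊂ 𝐏(ι; T)` a closed subscheme CONTAINED IN the vanishing locus
`V((kι ≫ φℙ)♭)` of the equations `ker ψ = g^*𝒦` (★ `Modules/VanishingLocusOfHom`, ★ B-p20 `SubbundleEquationsBaseChange`).  If `g'`
classifies `Z` through the monomial sections of `𝒪_Z(d)` (the letter of ★ β `existsUnique_hom_grassmannian_of_forall_fieldPoint`), then
`g = g'`.  Proof: on an affine `V`, a vector `z ∈ (pointsEquiv g)|_V = ker θ_V(g^*𝒬)` (★ `ker_sectionsMap_pullback_universalQuotient`) gives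
a section `θ(z)` of `ker ψ`, whose monomial combination on `Z` is `(kι ≫ φℙ ≫ π_*η_Z)(·) = 0` (★ `vanishingIdeal_transpose_le_ker_iff`) read
through `i^*𝒪_𝐏(d) ≅ 𝒪_Z(d)`, monomials ↦ monomials (★ (γ1) `pullbackTwistHom`); so `(pointsEquiv g)|_V ≤ ker θ_V(𝒪_Z(d), μ) =
(pointsEquiv g')|_V`, and points of the Grassmannian are incomparable (§1).
[cite: Mumford1966CurvesSurface, Lecture 15 (III) (pp. 105–108)] [cite: GortzWedhorn2020, (8.4) (pp. 213–215)] [cite: StacksProject, Tag 089R] -/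
theorem eq_of_classifies_of_le_ker_vanishingIdeal [Epi ψ] : g = g' := by
  classical
  let π := Morphisms.projectiveSpaceFst ι T
  let ιX := pullback.snd (terminal.from T) (terminal.from (Morphisms.projectiveSpaceInt ι))
  let L := SerreTwist.twistMod ιX (unitModule (Morphisms.projectiveSpace ι T)) d
  let N := (Scheme.Modules.pushforward (iZ ≫ π)).obj (SerreTwist.twistMod (iZ ≫ ιX) (unitModule Z) d)
  let E : (Scheme.Modules.pushforward π).obj ((Scheme.Modules.pushforward iZ).obj ((Scheme.Modules.pullback iZ).obj L)) ⟶ N :=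
    (Scheme.Modules.pushforwardComp iZ π).hom.app _ ≫
      (Scheme.Modules.pushforward (iZ ≫ π)).map (SerreTwist.pullbackTwistHom iZ ιX d)
  let ψZ : freeModule T (Fin d → Fin (Nat.card ι + 1)) ⟶ N :=
    φP ≫ (Scheme.Modules.pushforward π).map ((Scheme.Modules.pullbackPushforwardAdjunction iZ).unit.app L) ≫ E
  have hψZ : ∀ (w : Fin d → Fin (Nat.card ι + 1)) (V : T.Opens), ψZ.app V (freeSectionOn T w V) =
      N.presheaf.map (homOfLE (le_top : V ≤ ⊤)).op (SerreTwist.monomialSection (iZ ≫ ιX) d w) := by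
    intro w V
    change ((Scheme.Modules.pushforward (iZ ≫ π)).map (SerreTwist.pullbackTwistHom iZ ιX d)).app V
      ((((Scheme.Modules.pushforwardComp iZ π).hom.app _).app V)
        ((((Scheme.Modules.pushforward π).map ((Scheme.Modules.pullbackPushforwardAdjunction iZ).unit.app L)).app V)
          (φP.app V (freeSectionOn T w V)))) = _
    rw [hφP, Scheme.Modules.pushforwardComp_hom_app_app]
    change (SerreTwist.pullbackTwistHom iZ ιX d).app ((iZ ≫ π) ⁻¹ᵁ V)
      (((Scheme.Modules.pullbackPushforwardAdjunction iZ).unit.app L).app (π ⁻¹ᵁ V)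
        (L.presheaf.map (homOfLE (le_top : π ⁻¹ᵁ V ≤ ⊤)).op (SerreTwist.monomialSection ιX d w))) = _
    have hnat : ((Scheme.Modules.pullbackPushforwardAdjunction iZ).unit.app L).app (π ⁻¹ᵁ V)
        (L.presheaf.map (homOfLE (le_top : π ⁻¹ᵁ V ≤ ⊤)).op (SerreTwist.monomialSection ιX d w)) =
        unitSectionLE iZ L (V := ⊤) (le_top : (iZ ≫ π) ⁻¹ᵁ V ≤ iZ ⁻¹ᵁ ⊤) (SerreTwist.monomialSection ιX d w) := by
      erw [app_presheaf_map]
      rfl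
    rw [hnat]
    exact SerreTwist.pullbackTwistHom_app_unitSectionLE_monomialSection_le iZ ιX d w ((iZ ≫ π) ⁻¹ᵁ V)
  have hψZtop : (fun w => ψZ.app ⊤ (freeSectionOn T w ⊤)) = fun w => SerreTwist.monomialSection (iZ ≫ ιX) d w := by
    funext w
    rw [hψZ w ⊤, show homOfLE (le_top : (⊤ : T.Opens) ≤ ⊤) = 𝟙 _ from Subsingleton.elim _ _, op_id, N.presheaf.map_id]
    rfl
  have hK : IsAffineLocalizing (kernel ψ) :=
    isAffineLocalizing_of_isFiniteLocallyFree (HasRank.isFiniteLocallyFree'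
      (hasRank_kernel_of_epi_freeModule ψ (hasRank_pullback_universalQuotient k _ Finsupp.basisSingleOne g)))
  have hL : IsFiniteLocallyFree L := isFiniteLocallyFree_twistMod_unitModule ιX d
  have hzero : kernel.ι ψ ≫ ψZ = 0 := by
    have h0 : (kernel.ι ψ ≫ φP) ≫
        (Scheme.Modules.pushforward π).map ((Scheme.Modules.pullbackPushforwardAdjunction iZ).unit.app L) = 0 :=
      (vanishingIdeal_transpose_le_ker_iff π iZ (kernel.ι ψ ≫ φP) hK hL).1 hZ
    change kernel.ι ψ ≫ (φP ≫ (Scheme.Modules.pushforward π).map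
      ((Scheme.Modules.pullbackPushforwardAdjunction iZ).unit.app L) ≫ E) = 0
    rw [← Category.assoc, ← Category.assoc, h0, zero_comp]
  have hψtop : (fun w => ψ.app ⊤ (freeSectionOn T w ⊤)) = fun w =>
      unitSection g (universalQuotient k _ Finsupp.basisSingleOne) ⊤
        (universalQuotientSection k ((Fin d → Fin (Nat.card ι + 1)) →₀ ℤ) Finsupp.basisSingleOne w) := by
    funext w
    rw [hψ w ⊤, show homOfLE (le_top : (⊤ : T.Opens) ≤ ⊤) = 𝟙 _ from Subsingleton.elim _ _, op_id,
      ((Scheme.Modules.pullback g).obj (universalQuotient k _ Finsupp.basisSingleOne)).presheaf.map_id]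
    rfl
  refine eq_of_forall_evalAffine_le k _ fun V z hz => ?_
  rw [hcl V, LinearMap.mem_ker, ← hψZtop, sectionsMap_app_freeSectionOn_eq]
  have hz' : ψ.app V (sectionsMap Finsupp.basisSingleOne (freeModule T _) (fun w => freeSectionOn T w ⊤) V z) = 0 := by
    rw [← sectionsMap_app_freeSectionOn_eq, hψtop, ← LinearMap.mem_ker,
      ker_sectionsMap_pullback_universalQuotient k _ Finsupp.basisSingleOne g V.2]
    exact hz
  obtain ⟨κ, hκ⟩ := exists_kernel_ι_app_eq ψ V _ hz'
  rw [← hκ, ← CategoryTheory.comp_apply, ← Scheme.Modules.Hom.comp_app, hzero, Scheme.Modules.Hom.zero_app]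
  rfl

end PointOfVanishingLocus

/-! ## §3 (K) The vanishing locus of the equations sees only the sectionwise-kernel class of the presentation -/

section KernelClass

universe v

variable {T X : Scheme.{v}} (π : X ⟶ T) {F₁ F₂ Q₁ Q₂ : T.Modules} {L : X.Modules}
  (ψ₁ : F₁ ⟶ Q₁) (ψ₂ : F₂ ⟶ Q₂) (φ₁ : F₁ ⟶ (Scheme.Modules.pushforward π).obj L) (φ₂ : F₂ ⟶ (Scheme.Modules.pushforward π).obj L)

/-- If every local section `s₁` of `F₁` killed by `ψ₁` (on an affine open) has a partner `s₂` of `F₂` killed by `ψ₂` with the same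
value `φ₂ s₂ = φ₁ s₁`, then whatever kills `ker ψ₂` through `φ₂` kills `ker ψ₁` through `φ₁`
(★ `kernel_ι_comp_eq_zero_of_app`, ★ `exists_kernel_ι_app_eq`). [cite: Hartshorne1977, II Ex. 1.8 (p. 66)] -/
theorem kernel_ι_comp_comp_eq_zero_of_forall_exists
    (h₁₂ : ∀ V : T.Opens, IsAffineOpen V → ∀ s₁ : Γ(F₁, V), ψ₁.app V s₁ = 0 →
      ∃ s₂ : Γ(F₂, V), ψ₂.app V s₂ = 0 ∧ φ₂.app V s₂ = φ₁.app V s₁)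
    {G : T.Modules} (χ : (Scheme.Modules.pushforward π).obj L ⟶ G) (h0 : kernel.ι ψ₂ ≫ φ₂ ≫ χ = 0) :
    kernel.ι ψ₁ ≫ φ₁ ≫ χ = 0 := by
  refine kernel_ι_comp_eq_zero_of_app ψ₁ (φ₁ ≫ χ) fun V hV s₁ hs₁ => ?_
  obtain ⟨s₂, hs₂, h12⟩ := h₁₂ V hV s₁ hs₁
  obtain ⟨κ, hκ⟩ := exists_kernel_ι_app_eq ψ₂ V s₂ hs₂
  rw [Scheme.Modules.Hom.comp_app, CategoryTheory.comp_apply]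
  change χ.app V (φ₁.app V s₁) = 0
  rw [← h12, ← hκ, ← CategoryTheory.comp_apply, ← CategoryTheory.comp_apply, ← Scheme.Modules.Hom.comp_app,
    ← Scheme.Modules.Hom.comp_app, h0, Scheme.Modules.Hom.zero_app]
  rfl

/-- **(K) THE VANISHING LOCUS OF THE EQUATIONS `V((kι_ψ ≫ φ)♭)` DEPENDS ONLY ON THE VALUES `φ(s)`, `ψ s = 0`**: for
`ψᵢ : Fᵢ ⟶ Qᵢ` with affine-localizing kernels and `φᵢ : Fᵢ ⟶ π_* L` (`L` finite locally free on `π : X ⟶ T`) such that the local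
sections killed by `ψ₁` and by `ψ₂` have the same `φ`-values (on affine opens, in both directions), the closed subschemes of `X` cut out
by the transposes of `kernel.ι ψ₁ ≫ φ₁` and `kernel.ι ψ₂ ≫ φ₂` coincide — both are «the `b : Y ⟶ X` on which `φ(s)` pulls back to `0`
for every local section `s` with `ψ s = 0`» (★ `idealSheafData_eq_of_forall_le_ker_iff`, ★ B-p20 `vanishingIdeal_transpose_le_ker_iff`).
This is the independence of `Z_{g^*𝒦} ⊂ 𝐏` from the presentation of the point `g` ([Mumford1966CurvesSurface] Lect. 15 (IV.)–(V.)).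
[cite: Mumford1966CurvesSurface, Lecture 15 (IV.)–(V.) (pp. 107–108)] [cite: Fulton1998, B.3.4 (PDF p. 410)] -/
theorem vanishingIdeal_transpose_kernel_ι_comp_eq_of_forall_exists
    (hK₁ : IsAffineLocalizing (kernel ψ₁)) (hK₂ : IsAffineLocalizing (kernel ψ₂)) (hL : IsFiniteLocallyFree L)
    (h₁₂ : ∀ V : T.Opens, IsAffineOpen V → ∀ s₁ : Γ(F₁, V), ψ₁.app V s₁ = 0 →
      ∃ s₂ : Γ(F₂, V), ψ₂.app V s₂ = 0 ∧ φ₂.app V s₂ = φ₁.app V s₁)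
    (h₂₁ : ∀ V : T.Opens, IsAffineOpen V → ∀ s₂ : Γ(F₂, V), ψ₂.app V s₂ = 0 →
      ∃ s₁ : Γ(F₁, V), ψ₁.app V s₁ = 0 ∧ φ₁.app V s₁ = φ₂.app V s₂) :
    vanishingIdeal (((Scheme.Modules.pullbackPushforwardAdjunction π).homEquiv _ _).symm (kernel.ι ψ₁ ≫ φ₁)) =
      vanishingIdeal (((Scheme.Modules.pullbackPushforwardAdjunction π).homEquiv _ _).symm (kernel.ι ψ₂ ≫ φ₂)) := by
  apply Literature.AlgebraicGeometry.Morphisms.idealSheafData_eq_of_forall_le_ker_iff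
  intro Y b
  rw [vanishingIdeal_transpose_le_ker_iff π b _ hK₁ hL, vanishingIdeal_transpose_le_ker_iff π b _ hK₂ hL,
    Category.assoc, Category.assoc]
  exact ⟨kernel_ι_comp_comp_eq_zero_of_forall_exists π ψ₂ ψ₁ φ₂ φ₁ h₂₁ _,
    kernel_ι_comp_comp_eq_zero_of_forall_exists π ψ₁ ψ₂ φ₁ φ₂ h₁₂ _⟩

/-- **(K), one source**: two morphisms `ψ₁ : F ⟶ Q₁`, `ψ₂ : F ⟶ Q₂` with affine-localizing kernels and the SAME sectionwise kernels on
affine opens give the same vanishing locus `V((kι_{ψ₁} ≫ φ)♭) = V((kι_{ψ₂} ≫ φ)♭)` for any `φ : F ⟶ π_* L`.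
[cite: Mumford1966CurvesSurface, Lecture 15 (IV.)–(V.) (pp. 107–108)] [cite: Fulton1998, B.3.4 (PDF p. 410)] -/
theorem vanishingIdeal_transpose_kernel_ι_comp_eq {F : T.Modules} (ψ₁ : F ⟶ Q₁) (ψ₂ : F ⟶ Q₂)
    (φ : F ⟶ (Scheme.Modules.pushforward π).obj L)
    (hK₁ : IsAffineLocalizing (kernel ψ₁)) (hK₂ : IsAffineLocalizing (kernel ψ₂)) (hL : IsFiniteLocallyFree L)
    (h : ∀ V : T.Opens, IsAffineOpen V → ∀ s : Γ(F, V), ψ₁.app V s = 0 ↔ ψ₂.app V s = 0) :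
    vanishingIdeal (((Scheme.Modules.pullbackPushforwardAdjunction π).homEquiv _ _).symm (kernel.ι ψ₁ ≫ φ)) =
      vanishingIdeal (((Scheme.Modules.pullbackPushforwardAdjunction π).homEquiv _ _).symm (kernel.ι ψ₂ ≫ φ)) :=
  vanishingIdeal_transpose_kernel_ι_comp_eq_of_forall_exists π ψ₁ ψ₂ φ φ hK₁ hK₂ hL
    (fun V hV s hs => ⟨s, (h V hV s).1 hs, rfl⟩) fun V hV s hs => ⟨s, (h V hV s).2 hs, rfl⟩

/-- **The vanishing locus of the equations does not see an isomorphism on the TARGET bundle**: for `u : K ⟶ π_* L₁` and an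
isomorphism `θ : L₁ ⟶ L₂` of finite locally free modules, `V((u ≫ π_* θ)♭) = V(u♭)` (test on `b : Y ⟶ X`: naturality of the unit
`η_b` and `π_* b_* b^* θ` is an isomorphism). [cite: Fulton1998, B.3.4 (PDF p. 410)] -/
theorem vanishingIdeal_transpose_comp_pushforward_map_eq {K : T.Modules} {L₁ L₂ : X.Modules}
    (u : K ⟶ (Scheme.Modules.pushforward π).obj L₁) (θ : L₁ ⟶ L₂) [IsIso θ] (hK : IsAffineLocalizing K)
    (hL₁ : IsFiniteLocallyFree L₁) (hL₂ : IsFiniteLocallyFree L₂) :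
    vanishingIdeal (((Scheme.Modules.pullbackPushforwardAdjunction π).homEquiv _ _).symm
        (u ≫ (Scheme.Modules.pushforward π).map θ)) =
      vanishingIdeal (((Scheme.Modules.pullbackPushforwardAdjunction π).homEquiv _ _).symm u) := by
  apply Literature.AlgebraicGeometry.Morphisms.idealSheafData_eq_of_forall_le_ker_iff
  intro Y b
  rw [vanishingIdeal_transpose_le_ker_iff π b _ hK hL₂, vanishingIdeal_transpose_le_ker_iff π b _ hK hL₁, Category.assoc,
    ← Functor.map_comp]
  have hnat : θ ≫ (Scheme.Modules.pullbackPushforwardAdjunction b).unit.app L₂ =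
      (Scheme.Modules.pullbackPushforwardAdjunction b).unit.app L₁ ≫
        (Scheme.Modules.pushforward b).map ((Scheme.Modules.pullback b).map θ) :=
    (Scheme.Modules.pullbackPushforwardAdjunction b).unit.naturality θ
  rw [hnat, Functor.map_comp, ← Category.assoc]
  refine ⟨fun h0 => ?_, fun h0 => by rw [h0, zero_comp]⟩
  simpa using congrArg (· ≫ inv ((Scheme.Modules.pushforward π).map
    ((Scheme.Modules.pushforward b).map ((Scheme.Modules.pullback b).map θ)))) h0

end KernelClass

section KernelClassFree

variable {T X : Scheme.{u}} (π : X ⟶ T) {J : Type u} [Fintype J] {M : Type u} [AddCommGroup M] (b : Module.Basis J ℤ M)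
  {Q₁ Q₂ : T.Modules} {L : X.Modules} (ψ₁ : freeModule T J ⟶ Q₁) (ψ₂ : freeModule T J ⟶ Q₂)
  (φ : freeModule T J ⟶ (Scheme.Modules.pushforward π).obj L)

/-- **(K′) Two presentations `ψᵢ : 𝒪_T^{(J)} ⟶ Qᵢ` with the same kernels of their sections maps on every affine open cut out the
same closed subscheme of `X`**: `V((kι_{ψ₁} ≫ φ)♭) = V((kι_{ψ₂} ≫ φ)♭)` (★ `app_eq_zero_iff_of_ker_sectionsMap_eq` + (K)).  With both
kernels equal to `(pointsEquiv g)|_V` this says: the vanishing locus of the degree-`d` equations of a `T`-point `g` of the Grassmannian does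
not depend on the chosen quotient in the class `g`. [cite: Mumford1966CurvesSurface, Lecture 15 (IV.)–(V.) (pp. 107–108)] [cite: GortzWedhorn2020, (8.4) (pp. 213–215)] -/
theorem vanishingIdeal_transpose_kernel_ι_comp_eq_of_ker_sectionsMap_eq
    (hK₁ : IsAffineLocalizing (kernel ψ₁)) (hK₂ : IsAffineLocalizing (kernel ψ₂)) (hL : IsFiniteLocallyFree L)
    (h : ∀ V : T.affineOpens, LinearMap.ker (sectionsMap b Q₁ (fun j => ψ₁.app ⊤ (freeSectionOn T j ⊤)) V) =
      LinearMap.ker (sectionsMap b Q₂ (fun j => ψ₂.app ⊤ (freeSectionOn T j ⊤)) V)) :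
    vanishingIdeal (((Scheme.Modules.pullbackPushforwardAdjunction π).homEquiv _ _).symm (kernel.ι ψ₁ ≫ φ)) =
      vanishingIdeal (((Scheme.Modules.pullbackPushforwardAdjunction π).homEquiv _ _).symm (kernel.ι ψ₂ ≫ φ)) :=
  vanishingIdeal_transpose_kernel_ι_comp_eq π ψ₁ ψ₂ φ hK₁ hK₂ hL fun V hV s =>
    app_eq_zero_iff_of_ker_sectionsMap_eq b Q₁ ψ₁ ψ₂ V (h ⟨V, hV⟩) s

omit [Fintype J] in
/-- **Naturality of the sections maps in the module**: for `χ : N ⟶ N'` and global sections `q_j` of `N`,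
`θ_V(N', χ q) = χ_V ∘ θ_V(N, q)` (both `Γ(T, V)`-linear, equal on `1 ⊗ b_j`). [cite: GortzWedhorn2020, (8.4) (pp. 213–215)] -/
theorem sectionsMap_comp_app {N N' : T.Modules} (q : J → Γ(N, ⊤)) (χ : N ⟶ N') (V : T.Opens) (z : Γ(T, V) ⊗[ℤ] M) :
    sectionsMap b N' (fun j => χ.app ⊤ (q j)) V z = χ.app V (sectionsMap b N q V z) := by
  have key : sectionsMap b N' (fun j => χ.app ⊤ (q j)) V = appLinear χ V ∘ₗ sectionsMap b N q V := by
    refine TensorProduct.AlgebraTensorModule.ext fun a m => ?_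
    rw [LinearMap.comp_apply, sectionsMap_tmul b N' _ V a m, sectionsMap_tmul b N _ V a m, map_smul (appLinear χ V)]
    congr 1
    let f₁ : M →ₗ[ℤ] Γ(N', V) :=
      (sectionsMap b N' (fun j => χ.app ⊤ (q j)) V).restrictScalars ℤ ∘ₗ TensorProduct.mk ℤ Γ(T, V) M 1
    let f₂ : M →ₗ[ℤ] Γ(N', V) :=
      (appLinear χ V ∘ₗ sectionsMap b N q V).restrictScalars ℤ ∘ₗ TensorProduct.mk ℤ Γ(T, V) M 1
    have hf : f₁ = f₂ := by
      refine b.ext fun j => ?_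
      change sectionsMap b N' (fun j => χ.app ⊤ (q j)) V ((1 : Γ(T, V)) ⊗ₜ[ℤ] b j) =
        appLinear χ V (sectionsMap b N q V ((1 : Γ(T, V)) ⊗ₜ[ℤ] b j))
      rw [sectionsMap_one_tmul, sectionsMap_one_tmul, appLinear_apply, app_presheaf_map]
    exact LinearMap.congr_fun hf m
  rw [key, LinearMap.comp_apply, appLinear_apply]

end KernelClassFree

/-! ## §4 (EqBC) The equations of a Grassmannian point pull back along `𝐏(ι; T) → 𝐏(ι; Gr)` (Mumford Lect. 15 (IV.)) -/

section PullbackFreeSections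

variable {S T : Scheme.{u}} (g : T ⟶ S) {J : Type u} [Fintype J] {M : Type u} [AddCommGroup M] (b : Module.Basis J ℤ M)

/-- **Sections of `g^* 𝒪_S^{(J)}` are combinations of the pulled-back basis sections `η(ε_j)`**: every section over `V ⊆ T` is
`θ_V(z)` for the family `(η(ε_j))_j` (the pulled-back frame ★ `pullbackFrame` of ★ `freeModuleFrame`, ★ `eq_sum_coord_smul`).
[cite: Hartshorne1977, II §5 (p. 110)] -/
theorem exists_sectionsMap_unitSection_freeSectionOn_eq (V : T.Opens)
    (s : Γ((Scheme.Modules.pullback g).obj (freeModule S J), V)) :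
    ∃ z : Γ(T, V) ⊗[ℤ] M, sectionsMap b ((Scheme.Modules.pullback g).obj (freeModule S J))
      (fun j => (unitSection g (freeModule S J) ⊤ (freeSectionOn S j ⊤) :
        Γ((Scheme.Modules.pullback g).obj (freeModule S J), ⊤))) V z = s := by
  classical
  let e := pullbackFrame g (freeModuleFrame S J ⊤)
  refine ⟨∑ j, coord e (homOfLE (le_top : V ≤ g ⁻¹ᵁ ⊤)) s j ⊗ₜ[ℤ] b j, ?_⟩
  rw [map_sum]
  conv_rhs => rw [eq_sum_coord_smul e (homOfLE (le_top : V ≤ g ⁻¹ᵁ ⊤)) s]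
  refine Finset.sum_congr rfl fun j _ => ?_
  rw [sectionsMap_tmul, sectionsMap_one_tmul, basisSection_pullbackFrame, basisSection_freeModuleFrame]
  rfl

end PullbackFreeSections

section EquationsBaseChange

/-- `𝐏(ι; -)` is functorial: `𝐏(h ≫ g) = 𝐏(h) ≫ 𝐏(g)`. [cite: StacksProject, Tag 01NF] -/
theorem projectiveSpaceMap_comp {ι : Type u} [Finite ι] {S T T' : Scheme.{u}} (h : T' ⟶ T) (g : T ⟶ S) :
    Morphisms.projectiveSpaceMap ι (h ≫ g) = Morphisms.projectiveSpaceMap ι h ≫ Morphisms.projectiveSpaceMap ι g := by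
  apply pullback.hom_ext
  · change Morphisms.projectiveSpaceMap ι (h ≫ g) ≫ Morphisms.projectiveSpaceFst ι S =
      (Morphisms.projectiveSpaceMap ι h ≫ Morphisms.projectiveSpaceMap ι g) ≫ Morphisms.projectiveSpaceFst ι S
    rw [Morphisms.projectiveSpaceMap_fst, Category.assoc, Morphisms.projectiveSpaceMap_fst,
      Morphisms.projectiveSpaceMap_fst_assoc]
  · change Morphisms.projectiveSpaceMap ι (h ≫ g) ≫ pullback.snd _ _ =
      (Morphisms.projectiveSpaceMap ι h ≫ Morphisms.projectiveSpaceMap ι g) ≫ pullback.snd _ _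
    rw [Morphisms.projectiveSpaceMap_snd, Category.assoc, Morphisms.projectiveSpaceMap_snd, Morphisms.projectiveSpaceMap_snd]

/-- Transport of a (restricted) monomial section along an equality of the twisting morphisms. [cite: Hartshorne1977, II Prop. 5.12 (c)] -/
theorem eqToHom_twistMod_app_map_monomialSection {X : Scheme.{u}} {A : Type u} [CommRing A] {r : ℕ}
    {f f' : X ⟶ Morphisms.ProjCech.PP A r} (h : f = f') (e : ℕ) (w : Fin e → Fin (r + 1)) (U : X.Opens) :
    (eqToHom (congrArg (fun f => SerreTwist.twistMod f (unitModule X) e) h)).app U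
        ((SerreTwist.twistMod f (unitModule X) e).presheaf.map (homOfLE (le_top : U ≤ ⊤)).op (SerreTwist.monomialSection f e w)) =
      (SerreTwist.twistMod f' (unitModule X) e).presheaf.map (homOfLE (le_top : U ≤ ⊤)).op (SerreTwist.monomialSection f' e w) := by
  subst h
  rw [eqToHom_refl, Scheme.Modules.Hom.id_app]
  rfl

/-- **Monomials pull back to monomials, with the twisting morphism rewritten**: for `k : Y ⟶ Z`, `ιZ : Z ⟶ 𝐏ʳ_A` and
`ιY = k ≫ ιZ`, the base-change isomorphism `k^* 𝒪_Z(e) ⟶ 𝒪_Y(e)` (★ (γ1) `pullbackTwistHom`, transported along `k ≫ ιZ = ιY`) sends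
`η_k(μ_w)|_U` to `μ_w|_U`. [cite: Hartshorne1977, II Prop. 5.12 (c)] -/
theorem pullbackTwistHom_eqToHom_app_unitSectionLE_monomialSection {Y Z : Scheme.{u}} {A : Type u} [CommRing A] {r : ℕ}
    (k : Y ⟶ Z) (ιZ : Z ⟶ Morphisms.ProjCech.PP A r) {ιY : Y ⟶ Morphisms.ProjCech.PP A r} (h : k ≫ ιZ = ιY) (e : ℕ)
    (w : Fin e → Fin (r + 1)) (U : Y.Opens) :
    (SerreTwist.pullbackTwistHom k ιZ e ≫ eqToHom (congrArg (fun f => SerreTwist.twistMod f (unitModule Y) e) h)).app U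
        (unitSectionLE k (SerreTwist.twistMod ιZ (unitModule Z) e) (V := ⊤) (le_top : U ≤ k ⁻¹ᵁ ⊤)
          (SerreTwist.monomialSection ιZ e w)) =
      (SerreTwist.twistMod ιY (unitModule Y) e).presheaf.map (homOfLE (le_top : U ≤ ⊤)).op (SerreTwist.monomialSection ιY e w) := by
  subst h
  rw [eqToHom_refl, Category.comp_id]
  exact SerreTwist.pullbackTwistHom_app_unitSectionLE_monomialSection_le k ιZ e w U

variable {ι : Type} (d k : ℕ)
  [(grassmannianSheaf ((Fin d → Fin (Nat.card ι + 1)) →₀ ℤ) k).obj.IsRepresentable]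
  -- the monomial map `φGr : 𝒪^{(J)} ⟶ π_* 𝒪_𝐏(d)` of `𝐏(ι; Gr)`, `ε_w ↦ μ_w`
  (φGr : freeModule (grassmannianScheme ((Fin d → Fin (Nat.card ι + 1)) →₀ ℤ) k) (Fin d → Fin (Nat.card ι + 1)) ⟶
    (Scheme.Modules.pushforward (Morphisms.projectiveSpaceFst ι
      (grassmannianScheme ((Fin d → Fin (Nat.card ι + 1)) →₀ ℤ) k))).obj
      (SerreTwist.twistMod (pullback.snd (terminal.from (grassmannianScheme ((Fin d → Fin (Nat.card ι + 1)) →₀ ℤ) k))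
        (terminal.from (Morphisms.projectiveSpaceInt ι)))
        (unitModule (Morphisms.projectiveSpace ι (grassmannianScheme ((Fin d → Fin (Nat.card ι + 1)) →₀ ℤ) k))) d))
  (hφGr : ∀ (w : Fin d → Fin (Nat.card ι + 1)) (V : (grassmannianScheme ((Fin d → Fin (Nat.card ι + 1)) →₀ ℤ) k).Opens),
    φGr.app V (freeSectionOn _ w V) =
    (SerreTwist.twistMod (pullback.snd (terminal.from (grassmannianScheme ((Fin d → Fin (Nat.card ι + 1)) →₀ ℤ) k))
        (terminal.from (Morphisms.projectiveSpaceInt ι)))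
        (unitModule (Morphisms.projectiveSpace ι (grassmannianScheme ((Fin d → Fin (Nat.card ι + 1)) →₀ ℤ) k))) d).presheaf.map
      (homOfLE (le_top : (Morphisms.projectiveSpaceFst ι (grassmannianScheme ((Fin d → Fin (Nat.card ι + 1)) →₀ ℤ) k)) ⁻¹ᵁ V ≤
        ⊤)).op
      (SerreTwist.monomialSection (pullback.snd (terminal.from (grassmannianScheme ((Fin d → Fin (Nat.card ι + 1)) →₀ ℤ) k))
        (terminal.from (Morphisms.projectiveSpaceInt ι))) d w))
  {T : Scheme.{0}} (g : T ⟶ grassmannianScheme ((Fin d → Fin (Nat.card ι + 1)) →₀ ℤ) k)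
  -- the monomial map of `𝐏(ι; T)`
  (φT : freeModule T (Fin d → Fin (Nat.card ι + 1)) ⟶
    (Scheme.Modules.pushforward (Morphisms.projectiveSpaceFst ι T)).obj
      (SerreTwist.twistMod (pullback.snd (terminal.from T) (terminal.from (Morphisms.projectiveSpaceInt ι)))
        (unitModule (Morphisms.projectiveSpace ι T)) d))
  (hφT : ∀ (w : Fin d → Fin (Nat.card ι + 1)) (V : T.Opens), φT.app V (freeSectionOn T w V) =
    (SerreTwist.twistMod (pullback.snd (terminal.from T) (terminal.from (Morphisms.projectiveSpaceInt ι)))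
        (unitModule (Morphisms.projectiveSpace ι T)) d).presheaf.map
      (homOfLE (le_top : (Morphisms.projectiveSpaceFst ι T) ⁻¹ᵁ V ≤ ⊤)).op
      (SerreTwist.monomialSection (pullback.snd (terminal.from T) (terminal.from (Morphisms.projectiveSpaceInt ι))) d w))
  -- any presentation `ψT` of a quotient in the class `g`
  {QT : T.Modules} (ψT : freeModule T (Fin d → Fin (Nat.card ι + 1)) ⟶ QT)
  (hclT : ∀ V : T.affineOpens,
    (evalAffine V.2 (pointsEquiv ((Fin d → Fin (Nat.card ι + 1)) →₀ ℤ) k T g)).toSubmodule =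
      LinearMap.ker (sectionsMap (Finsupp.basisSingleOne : Module.Basis (Fin d → Fin (Nat.card ι + 1)) ℤ _) QT
        (fun w => ψT.app ⊤ (freeSectionOn T w ⊤)) V))
  (hKT : IsAffineLocalizing (kernel ψT))

include hφGr hφT hclT hKT in
/-- **(EqBC) THE EQUATIONS OF A GRASSMANNIAN POINT ARE THE PULL-BACK OF THE UNIVERSAL EQUATIONS** ([Mumford1966CurvesSurface] Lect. 15
(IV.) «`Z_K ×_S T = Z_{h^*K}`», in ideal form): for `g : T ⟶ Gr = Grass_k(ℤ^{(Mon_d)})`, the pull-back along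
`𝐏(g) : 𝐏(ι; T) → 𝐏(ι; Gr)` (Mathlib `IdealSheafData.comap`) of the ideal sheaf `V((kι_𝒦 ≫ φGr)♭)` cut out by the universal subbundle
`𝒦 = ker(𝒪^{(Mon_d)} ↠ 𝒬)` through the monomial map `φGr` IS the ideal sheaf `V((kι_{ψT} ≫ φT)♭)` cut out by the kernel of ANY
presentation `ψT : 𝒪_T^{(Mon_d)} ⟶ QT` of a quotient in the class `g` (`ker θ_V(QT, ψT ε) = (pointsEquiv g)|_V` on affine `V`).
Proof: ★ `comap_vanishingIdeal_transpose_of_iso` along the square `𝐏(g) ≫ π_{Gr} = π_T ≫ g` (source `g^*𝒦 ≅ ker(g^*π)`), then (K)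
with `Σ a_w η(ε_w) ↔ Σ a_w ε_w` (both killed iff `a ∈ (pointsEquiv g)|_V`; same values `Σ a_w μ_w`: monomials pull back to monomials,
★ `pushforwardBaseChangeHom_app_unitSectionLE`, ★ (γ1) `pullbackTwistHom`), the target iso `𝐏(g)^*𝒪(d) ≅ 𝒪(d)` being invisible to `V`.
[cite: Mumford1966CurvesSurface, Lecture 15 (IV.)–(V.) (pp. 107–108)] [cite: GortzWedhorn2020, Prop. 4.20] [cite: Hartshorne1977, II Prop. 5.12 (c)] -/
theorem comap_vanishingIdeal_universalEquations_eq :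
    (vanishingIdeal (((Scheme.Modules.pullbackPushforwardAdjunction
        (Morphisms.projectiveSpaceFst ι (grassmannianScheme ((Fin d → Fin (Nat.card ι + 1)) →₀ ℤ) k))).homEquiv _ _).symm
        (kernel.ι (universalQuotientπ k ((Fin d → Fin (Nat.card ι + 1)) →₀ ℤ) Finsupp.basisSingleOne) ≫ φGr))).comap
        (Morphisms.projectiveSpaceMap ι g) =
      vanishingIdeal (((Scheme.Modules.pullbackPushforwardAdjunction (Morphisms.projectiveSpaceFst ι T)).homEquiv _ _).symm
        (kernel.ι ψT ≫ φT)) := by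
  classical
  -- notation-free abbreviations
  let Gr := grassmannianScheme ((Fin d → Fin (Nat.card ι + 1)) →₀ ℤ) k
  let πGr := Morphisms.projectiveSpaceFst ι Gr
  let πT := Morphisms.projectiveSpaceFst ι T
  let pr := Morphisms.projectiveSpaceMap ι g
  let sGr := pullback.snd (terminal.from Gr) (terminal.from (Morphisms.projectiveSpaceInt ι))
  let sT := pullback.snd (terminal.from T) (terminal.from (Morphisms.projectiveSpaceInt ι))
  let LGr := SerreTwist.twistMod sGr (unitModule (Morphisms.projectiveSpace ι Gr)) d
  let LT := SerreTwist.twistMod sT (unitModule (Morphisms.projectiveSpace ι T)) d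
  let FGr := freeModule Gr (Fin d → Fin (Nat.card ι + 1))
  let Q := universalQuotient k ((Fin d → Fin (Nat.card ι + 1)) →₀ ℤ)
    (Finsupp.basisSingleOne : Module.Basis (Fin d → Fin (Nat.card ι + 1)) ℤ _)
  let πu := universalQuotientπ k ((Fin d → Fin (Nat.card ι + 1)) →₀ ℤ)
    (Finsupp.basisSingleOne : Module.Basis (Fin d → Fin (Nat.card ι + 1)) ℤ _)
  have hsq : pr ≫ πGr = πT ≫ g := Morphisms.projectiveSpaceMap_fst ι g
  have hsnd : pr ≫ sGr = sT := Morphisms.projectiveSpaceMap_snd ι g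
  haveI := epi_universalQuotientπ k ((Fin d → Fin (Nat.card ι + 1)) →₀ ℤ)
    (Finsupp.basisSingleOne : Module.Basis (Fin d → Fin (Nat.card ι + 1)) ℤ _)
  haveI := epi_map_pullback_universalQuotientπ k ((Fin d → Fin (Nat.card ι + 1)) →₀ ℤ)
    (Finsupp.basisSingleOne : Module.Basis (Fin d → Fin (Nat.card ι + 1)) ℤ _) g
  have hK : IsAffineLocalizing (kernel πu) :=
    isAffineLocalizing_of_isFiniteLocallyFree (HasRank.isFiniteLocallyFree'
      (hasRank_kernel_of_epi_freeModule πu (hasRank_universalQuotient k _ Finsupp.basisSingleOne)))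
  have hK' : IsAffineLocalizing (kernel ((Scheme.Modules.pullback g).map πu)) :=
    isAffineLocalizing_of_isFiniteLocallyFree (HasRank.isFiniteLocallyFree'
      (hasRank_kernel_map_pullback_universalQuotientπ k _ Finsupp.basisSingleOne g))
  have hLGr : IsFiniteLocallyFree LGr := isFiniteLocallyFree_twistMod_unitModule sGr d
  have hLT : IsFiniteLocallyFree LT := isFiniteLocallyFree_twistMod_unitModule sT d
  -- Step 1: base change of `V((kι ≫ φGr)♭)` along `pr`, source `ker(g^*π) ≅ g^*𝒦`
  obtain ⟨E, hE⟩ := exists_iso_pullback_kernel_universalQuotientπ k ((Fin d → Fin (Nat.card ι + 1)) →₀ ℤ)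
    (Finsupp.basisSingleOne : Module.Basis (Fin d → Fin (Nat.card ι + 1)) ℤ _) g
  have hE' : E.inv ≫ (Scheme.Modules.pullback g).map (kernel.ι πu) = kernel.ι ((Scheme.Modules.pullback g).map πu) := by
    rw [← hE, E.inv_hom_id_assoc]
  have step1 := comap_vanishingIdeal_transpose_of_iso hsq (kernel.ι πu ≫ φGr) hK hLGr hK' E.symm
  rw [Iso.symm_hom, Functor.map_comp, Category.assoc, ← Category.assoc E.inv, hE'] at step1
  change (vanishingIdeal (((Scheme.Modules.pullbackPushforwardAdjunction πGr).homEquiv _ _).symm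
    (kernel.ι πu ≫ φGr))).comap pr = _
  rw [step1]
  -- Step 2: the target isomorphism `θ : pr^* 𝒪_{𝐏Gr}(d) ≅ 𝒪_{𝐏T}(d)` is invisible
  let θ : (Scheme.Modules.pullback pr).obj LGr ⟶ LT :=
    SerreTwist.pullbackTwistHom pr sGr d ≫
      eqToHom (congrArg (fun f => SerreTwist.twistMod f (unitModule (Morphisms.projectiveSpace ι T)) d) hsnd)
  haveI : IsIso (SerreTwist.pullbackTwistHom pr sGr d) := SerreTwist.isIso_pullbackTwistHom pr sGr d
  haveI : IsIso θ := IsIso.comp_isIso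
  rw [← vanishingIdeal_transpose_comp_pushforward_map_eq πT (kernel.ι ((Scheme.Modules.pullback g).map πu) ≫
      (Scheme.Modules.pullback g).map φGr ≫ pushforwardBaseChangeHom hsq LGr) θ hK' (hLGr.pullback pr) hLT,
    Category.assoc, Category.assoc]
  -- the composite `Φ : g^*𝒪^{(J)} ⟶ πT_* 𝒪_{𝐏T}(d)` and its values on the pulled-back basis sections
  let Φ : (Scheme.Modules.pullback g).obj FGr ⟶ (Scheme.Modules.pushforward πT).obj LT :=
    (Scheme.Modules.pullback g).map φGr ≫ pushforwardBaseChangeHom hsq LGr ≫ (Scheme.Modules.pushforward πT).map θ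
  let q₁ : (Fin d → Fin (Nat.card ι + 1)) → Γ((Scheme.Modules.pullback g).obj FGr, ⊤) := fun w =>
    (unitSection g FGr ⊤ (freeSectionOn Gr w ⊤) : Γ((Scheme.Modules.pullback g).obj FGr, ⊤))
  have hΦ : ∀ wd, Φ.app ⊤ (q₁ wd) = φT.app ⊤ (freeSectionOn T wd ⊤) := by
    intro wd
    have h1 : ((Scheme.Modules.pullback g).map φGr).app ⊤ (q₁ wd) =
        unitSectionLE g ((Scheme.Modules.pushforward πGr).obj LGr) (V := ⊤) (U := ⊤) le_top
          (φGr.app ⊤ (freeSectionOn Gr wd ⊤)) := by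
      change ((Scheme.Modules.pullback g).map φGr).app (g ⁻¹ᵁ ⊤) (unitSection g FGr ⊤ (freeSectionOn Gr wd ⊤)) = _
      rw [pullback_map_app_unitSection, unitSectionLE,
        show (homOfLE (le_top : (⊤ : T.Opens) ≤ g ⁻¹ᵁ ⊤)).op = 𝟙 _ from Subsingleton.elim _ _]
      erw [CategoryTheory.Functor.map_id]
      rfl
    have hle' : πT ⁻¹ᵁ (⊤ : T.Opens) ≤ pr ⁻¹ᵁ (πGr ⁻¹ᵁ (⊤ : Gr.Opens)) := fun _ _ => trivial
    have h2 : (pushforwardBaseChangeHom hsq LGr).app ⊤ (unitSectionLE g ((Scheme.Modules.pushforward πGr).obj LGr)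
        (V := ⊤) (U := ⊤) le_top (φGr.app ⊤ (freeSectionOn Gr wd ⊤))) =
        unitSectionLE pr LGr (V := πGr ⁻¹ᵁ ⊤) (U := πT ⁻¹ᵁ ⊤) hle' (φGr.app ⊤ (freeSectionOn Gr wd ⊤)) :=
      pushforwardBaseChangeHom_app_unitSectionLE hsq LGr _ _
    have h3 : unitSectionLE pr LGr (V := πGr ⁻¹ᵁ ⊤) (U := πT ⁻¹ᵁ ⊤) hle' (φGr.app ⊤ (freeSectionOn Gr wd ⊤)) =
        unitSectionLE pr LGr (V := ⊤) (U := πT ⁻¹ᵁ ⊤) le_top (SerreTwist.monomialSection sGr d wd) := by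
      rw [hφGr wd ⊤, unitSectionLE_map_of_le (g := pr) (UX := ⊤) (UX' := πGr ⁻¹ᵁ ⊤) (UY := πT ⁻¹ᵁ ⊤) (UY' := πT ⁻¹ᵁ ⊤)
          LGr le_top hle' le_top (le_refl _),
        show homOfLE (le_refl (πT ⁻¹ᵁ (⊤ : T.Opens))) = 𝟙 _ from rfl, op_id, CategoryTheory.Functor.map_id]
      rfl
    have h4 : θ.app (πT ⁻¹ᵁ ⊤) (unitSectionLE pr LGr (V := ⊤) (U := πT ⁻¹ᵁ ⊤) le_top (SerreTwist.monomialSection sGr d wd)) =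
        LT.presheaf.map (homOfLE (le_top : πT ⁻¹ᵁ ⊤ ≤ ⊤)).op (SerreTwist.monomialSection sT d wd) := by
      exact pullbackTwistHom_eqToHom_app_unitSectionLE_monomialSection pr sGr hsnd d wd (πT ⁻¹ᵁ ⊤)
    change ((Scheme.Modules.pushforward πT).map θ).app ⊤ ((pushforwardBaseChangeHom hsq LGr).app ⊤
      (((Scheme.Modules.pullback g).map φGr).app ⊤ (q₁ wd))) = _
    rw [h1, h2, h3, Scheme.Modules.pushforward_map_app]
    exact h4.trans (hφT wd ⊤).symm
  have hq : ∀ wd, ((Scheme.Modules.pullback g).map πu).app ⊤ (q₁ wd) =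
      unitSection g Q ⊤ (universalQuotientSection k _ Finsupp.basisSingleOne wd) := by
    intro wd
    change ((Scheme.Modules.pullback g).map πu).app (g ⁻¹ᵁ ⊤) (unitSection g FGr ⊤ (freeSectionOn Gr wd ⊤)) = _
    rw [pullback_map_app_unitSection, universalQuotientπ_app_top_freeSectionOn]
  -- the correspondence `S₁ z = Σ a_w η(ε_w)  ↔  θT z = Σ a_w ε_w`
  have hker : ∀ (V : T.Opens) (hV : IsAffineOpen V) (z : Γ(T, V) ⊗[ℤ] ((Fin d → Fin (Nat.card ι + 1)) →₀ ℤ)),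
      ((Scheme.Modules.pullback g).map πu).app V (sectionsMap Finsupp.basisSingleOne _ q₁ V z) = 0 ↔
        ψT.app V (sectionsMap Finsupp.basisSingleOne (freeModule T _) (fun w => freeSectionOn T w ⊤) V z) = 0 := by
    intro V hV z
    rw [← sectionsMap_comp_app, funext hq, ← LinearMap.mem_ker,
      ker_sectionsMap_pullback_universalQuotient k _ Finsupp.basisSingleOne g hV, hclT ⟨V, hV⟩, LinearMap.mem_ker,
      sectionsMap_app_freeSectionOn_eq]
  have hval : ∀ (V : T.Opens) (z : Γ(T, V) ⊗[ℤ] ((Fin d → Fin (Nat.card ι + 1)) →₀ ℤ)),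
      Φ.app V (sectionsMap Finsupp.basisSingleOne _ q₁ V z) =
        φT.app V (sectionsMap Finsupp.basisSingleOne (freeModule T _) (fun w => freeSectionOn T w ⊤) V z) := by
    intro V z
    rw [← sectionsMap_comp_app, funext hΦ, sectionsMap_app_freeSectionOn_eq]
  -- Step 3: (K) for `g^*π` (source `g^*𝒪^{(J)}`) and `ψT` (source `𝒪_T^{(J)}`)
  refine vanishingIdeal_transpose_kernel_ι_comp_eq_of_forall_exists πT ((Scheme.Modules.pullback g).map πu) ψT Φ φT
    hK' hKT hLT (fun V hV s₁ hs₁ => ?_) fun V hV s₂ hs₂ => ?_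
  · obtain ⟨z, rfl⟩ := exists_sectionsMap_unitSection_freeSectionOn_eq g Finsupp.basisSingleOne V s₁
    exact ⟨_, (hker V hV z).1 hs₁, (hval V z).symm⟩
  · obtain ⟨z, rfl⟩ := sectionsMap_freeModule_surjective
      (Finsupp.basisSingleOne : Module.Basis (Fin d → Fin (Nat.card ι + 1)) ℤ _) V s₂
    exact ⟨_, (hker V hV z).2 hs₂, hval V z⟩

end EquationsBaseChange

end Literature.AlgebraicGeometry.Motives

end
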